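import Mathlib
import HarnessLib
import Summits.NavierStokesRegularity.NavierStokesRegularity.Theorems.PoloidalWindowDoorPoloidalWindowRigidityLargeScaleEnergyBootstrap

/-!
# Route `PoloidalWindowDoor`, crux `PoloidalWindowRigidity` (K2, stmt-NavierStokesRegularity-19708) — whole-class tool:
# slice estimates for the FLOOR of the large-scale energy bootstrap (`L²` pressure oscillation, Cauchy–Schwarz)

Cell ns-regularity-ideate, seat ns-poloidal-K2-p3 gen 3 (stub-worker under the K2 lead; file landed
`--supports stmt-NavierStokesRegularity-19708` as a helper).  With the `L^{3/2}` class pressure bound the bootstrap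
`…LargeScaleEnergyBootstrapLevels` stops at `3/2 = 3 − 3/2`; with the `L²` bound (`…LargeScaleEnergyPressureTwo`) the
map becomes `α ↦ (1+α)/2`, whose fixed point is the scale-invariant floor `α = 1` (step: `…BootstrapFloorStep`).
* `le_rpow_half_mul_rpow_half`, `setIntegral_norm_rpow_three_le_two` — `∫_K ‖w‖³ ≤ M²|K|^{1/2} e^{1/2}`
  (`∫_K‖w‖³ ≤ min(Me, M³|K|)`);
* `flux_le_two` — slice flux `≤ C₂/R²·e + C₁/R·|B̄_{2R}|^{1/2} e^{1/2}(M² + 2P)` under `∃ c, ∫|p−c|² ≤ P²|B̄_{2R}|`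
  (pressure term by CAUCHY–SCHWARZ after the constant drops out).

WHAT THIS IS NOT: not a claim about Navier–Stokes regularity — calculus/measure bookkeeping (bears_on LADDER-NS N0).
-/

noncomputable section

-- the summit and its single sub-problem share the name (CONVENTIONS §1), as in every Theorems file
set_option linter.dupNamespace false

namespace Summit.NavierStokesRegularity.NavierStokesRegularity.Theorems.PoloidalWindowDoorPoloidalWindowRigidityLargeScaleEnergyBootstrapFloorTools

open MeasureTheory Set Function Filter Topology TopologicalSpace Metric InnerProductSpace
open scoped RealInnerProductSpace InnerProductSpace Laplacian ContDiff
open Literature.Analysis Literature.Analysis.FluidPDE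
open Summit.NavierStokesRegularity.NavierStokesRegularity.Theorems.PoloidalWindowDoorPoloidalWindowRigidityLargeScaleEnergyDecayTools
  (integral_fderiv_cutoff_apply_eq_zero setIntegral_ball_le_integral_cutoff)
open Summit.NavierStokesRegularity.NavierStokesRegularity.Theorems.PoloidalWindowDoorPoloidalWindowRigidityLargeScaleEnergyBootstrapTools
open Summit.NavierStokesRegularity.NavierStokesRegularity.Theorems.PoloidalWindowDoorPoloidalWindowRigidityLargeScaleEnergyBootstrap

variable {S : Set ℝ} {u : ℝ → EuclideanSpace ℝ (Fin 3) → EuclideanSpace ℝ (Fin 3)}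
  {p : ℝ → EuclideanSpace ℝ (Fin 3) → ℝ}

/-! ### The cubic interpolation, `L²` form -/

/-- Elementary interpolation: if `0 ≤ x ≤ a` and `x ≤ b` then `x ≤ b^{1/2} a^{1/2}`. -/
theorem le_rpow_half_mul_rpow_half {x a b : ℝ} (hx : 0 ≤ x) (hxa : x ≤ a) (hxb : x ≤ b) :
    x ≤ b ^ (1 / 2 : ℝ) * a ^ (1 / 2 : ℝ) := by
  have hb : 0 ≤ b := hx.trans hxb
  have h1 : x ^ (1 / 2 : ℝ) ≤ b ^ (1 / 2 : ℝ) := Real.rpow_le_rpow hx hxb (by norm_num)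
  have h2 : x ^ (1 / 2 : ℝ) ≤ a ^ (1 / 2 : ℝ) := Real.rpow_le_rpow hx hxa (by norm_num)
  have hx' : x = x ^ (1 / 2 : ℝ) * x ^ (1 / 2 : ℝ) := by
    rw [← Real.rpow_add' hx (by norm_num)]; norm_num
  rw [hx']
  exact mul_le_mul h1 h2 (Real.rpow_nonneg hx _) (Real.rpow_nonneg hb _)

/-- **Cubic interpolation, `L²` form.**  For a continuous slice `w` with `‖w‖ ≤ M` and `∫_K ‖w‖² ≤ e`
(`K = B̄(0,2R)`): `∫_K ‖w‖³ ≤ (M³|K|)^{1/2}(Me)^{1/2} = M²|K|^{1/2} e^{1/2}`. [folklore] -/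
theorem setIntegral_norm_rpow_three_le_two {w : EuclideanSpace ℝ (Fin 3) → EuclideanSpace ℝ (Fin 3)}
    (hw : Continuous w) {R M e : ℝ} (hM : ∀ x, ‖w x‖ ≤ M)
    (he : ∫ x in closedBall (0 : EuclideanSpace ℝ (Fin 3)) (2 * R), ‖w x‖ ^ 2 ≤ e) :
    ∫ x in closedBall (0 : EuclideanSpace ℝ (Fin 3)) (2 * R), ‖w x‖ ^ (3 : ℝ) ≤
      M ^ 2 * volume.real (closedBall (0 : EuclideanSpace ℝ (Fin 3)) (2 * R)) ^ (1 / 2 : ℝ) * e ^ (1 / 2 : ℝ) := by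
  set K : Set (EuclideanSpace ℝ (Fin 3)) := closedBall (0 : EuclideanSpace ℝ (Fin 3)) (2 * R) with hKdef
  have hKm : MeasurableSet K := isClosed_closedBall.measurableSet
  have hKfin : volume K < ⊤ := measure_closedBall_lt_top
  have hKc : IsCompact K := isCompact_closedBall _ _
  have hM0 : 0 ≤ M := (norm_nonneg _).trans (hM 0)
  have hV0 : 0 ≤ volume.real K := measureReal_nonneg
  have he0 : 0 ≤ e := (setIntegral_nonneg hKm fun x _ => sq_nonneg _).trans he
  have h3c : Continuous fun x => ‖w x‖ ^ (3 : ℝ) := (hw.norm).rpow_const fun _ => Or.inr (by norm_num)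
  have h3i : IntegrableOn (fun x => ‖w x‖ ^ (3 : ℝ)) K volume := h3c.continuousOn.integrableOn_compact hKc
  have h2i : IntegrableOn (fun x => ‖w x‖ ^ 2) K volume := (hw.norm.pow 2).continuousOn.integrableOn_compact hKc
  have hI0 : 0 ≤ ∫ x in K, ‖w x‖ ^ (3 : ℝ) :=
    setIntegral_nonneg hKm fun x _ => Real.rpow_nonneg (norm_nonneg _) _
  have hcube : ∀ x, ‖w x‖ ^ (3 : ℝ) = ‖w x‖ ^ 2 * ‖w x‖ := fun x => by
    rw [show (3 : ℝ) = ((3 : ℕ) : ℝ) by norm_num, Real.rpow_natCast]; ring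
  have hA : ∫ x in K, ‖w x‖ ^ (3 : ℝ) ≤ M * e := by
    calc ∫ x in K, ‖w x‖ ^ (3 : ℝ) ≤ ∫ x in K, M * ‖w x‖ ^ 2 := by
          refine setIntegral_mono_on h3i (h2i.const_mul M) hKm fun x _ => ?_
          rw [hcube, mul_comm M]
          exact mul_le_mul_of_nonneg_left (hM x) (sq_nonneg _)
      _ = M * ∫ x in K, ‖w x‖ ^ 2 := integral_const_mul _ _
      _ ≤ M * e := mul_le_mul_of_nonneg_left he hM0
  have hB : ∫ x in K, ‖w x‖ ^ (3 : ℝ) ≤ M ^ 3 * volume.real K := by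
    calc ∫ x in K, ‖w x‖ ^ (3 : ℝ) ≤ ∫ x in K, M ^ 3 := by
          refine setIntegral_mono_on h3i (integrableOn_const hKfin.ne) hKm fun x _ => ?_
          rw [show (3 : ℝ) = ((3 : ℕ) : ℝ) by norm_num, Real.rpow_natCast]
          exact pow_le_pow_left₀ (norm_nonneg _) (hM x) 3
      _ = M ^ 3 * volume.real K := by rw [setIntegral_const, smul_eq_mul, mul_comm]
  have h := le_rpow_half_mul_rpow_half hI0 hA hB
  -- `(M³V)^{1/2} (Me)^{1/2} = M² V^{1/2} e^{1/2}`
  have e1 : (M ^ 3 * volume.real K) ^ (1 / 2 : ℝ) * (M * e) ^ (1 / 2 : ℝ) =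
      M ^ 2 * volume.real K ^ (1 / 2 : ℝ) * e ^ (1 / 2 : ℝ) := by
    rw [Real.mul_rpow (pow_nonneg hM0 3) hV0, Real.mul_rpow hM0 he0,
      show M ^ 3 = M ^ (3 : ℝ) by rw [show (3 : ℝ) = ((3 : ℕ) : ℝ) by norm_num, Real.rpow_natCast],
      ← Real.rpow_mul hM0]
    have hMM : M ^ ((3 : ℝ) * (1 / 2)) * M ^ (1 / 2 : ℝ) = M ^ 2 := by
      rw [← Real.rpow_add' hM0 (by norm_num)]; norm_num
    calc M ^ ((3 : ℝ) * (1 / 2)) * volume.real K ^ (1 / 2 : ℝ) * (M ^ (1 / 2 : ℝ) * e ^ (1 / 2 : ℝ))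
        = (M ^ ((3 : ℝ) * (1 / 2)) * M ^ (1 / 2 : ℝ)) * volume.real K ^ (1 / 2 : ℝ) * e ^ (1 / 2 : ℝ) := by ring
      _ = M ^ 2 * volume.real K ^ (1 / 2 : ℝ) * e ^ (1 / 2 : ℝ) := by rw [hMM]
  rw [e1] at h
  exact h

/-! ### The slice flux bound with an `L²` pressure oscillation -/

/-- **Slice bound of the cut-off energy flux (`L²` form).**  At a time `s ∈ S` with `‖u(s,·)‖ ≤ M`, the
slice energy bound `∫_{B̄(0,2R)} ‖u(s)‖² ≤ e` and the `L²` mean-oscillation bound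
`∫_{B̄(0,2R)} |p(s) − c|² ≤ P²|B̄(0,2R)|` (`P ≥ 0`, some constant `c`), the flux of
`local_energy_identity_cutoff` (viscosity `1`, `φ = cutoff R`, `‖Dφ‖ ≤ C₁/R`, `|Δφ| ≤ C₂/R²`) satisfies
`∫ (Δφ|u|² + Dφ(u)|u|² + 2 p Dφ(u)) ≤ C₂/R²·e + C₁/R·|B̄(0,2R)|^{1/2}·e^{1/2}·(M² + 2P)` (cubic term by
`∫‖u‖³ ≤ min(Me, M³|K|) ≤ M²|K|^{1/2}e^{1/2}`, pressure term by CAUCHY–SCHWARZ). -/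
theorem flux_le_two (h : IsClassicalNSSolutionOn S 1 0 u p) {s : ℝ} (hs : s ∈ S)
    {M e P R C₁ C₂ : ℝ} (hR : 0 < R) (hM : ∀ x, ‖u s x‖ ≤ M) (hP : 0 ≤ P)
    (he : ∫ x in closedBall (0 : EuclideanSpace ℝ (Fin 3)) (2 * R), ‖u s x‖ ^ 2 ≤ e)
    (hosc : ∃ c : ℝ, ∫ x in closedBall (0 : EuclideanSpace ℝ (Fin 3)) (2 * R), |p s x - c| ^ (2 : ℝ) ≤
      P ^ (2 : ℝ) * volume.real (closedBall (0 : EuclideanSpace ℝ (Fin 3)) (2 * R)))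
    (hC₁ : ∀ x, ‖fderiv ℝ (cutoff (E := EuclideanSpace ℝ (Fin 3)) R) x‖ ≤ C₁ / R)
    (hC₂ : ∀ x, |(Δ (cutoff (E := EuclideanSpace ℝ (Fin 3)) R)) x| ≤ C₂ / R ^ 2) :
    ∫ x, (1 * ((Δ (cutoff (E := EuclideanSpace ℝ (Fin 3)) R)) x * ‖u s x‖ ^ 2) +
        fderiv ℝ (cutoff (E := EuclideanSpace ℝ (Fin 3)) R) x (u s x) * ‖u s x‖ ^ 2 +
        2 * (p s x * fderiv ℝ (cutoff (E := EuclideanSpace ℝ (Fin 3)) R) x (u s x))) ≤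
      C₂ / R ^ 2 * e + C₁ / R * volume.real (closedBall (0 : EuclideanSpace ℝ (Fin 3)) (2 * R)) ^ (1 / 2 : ℝ) *
        e ^ (1 / 2 : ℝ) * (M ^ 2 + 2 * P) := by
  obtain ⟨c, hc⟩ := hosc
  set φ : EuclideanSpace ℝ (Fin 3) → ℝ := cutoff (E := EuclideanSpace ℝ (Fin 3)) R with hφdef
  set K : Set (EuclideanSpace ℝ (Fin 3)) := closedBall (0 : EuclideanSpace ℝ (Fin 3)) (2 * R) with hKdef
  set V : ℝ := volume.real K with hVdef
  have hM0 : 0 ≤ M := (norm_nonneg _).trans (hM 0)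
  have he0 : 0 ≤ e := (setIntegral_nonneg isClosed_closedBall.measurableSet fun x _ => sq_nonneg _).trans he
  have hC₁0 : 0 ≤ C₁ / R := (norm_nonneg _).trans (hC₁ 0)
  have hC₂0 : 0 ≤ C₂ / R ^ 2 := (abs_nonneg _).trans (hC₂ 0)
  have hKm : MeasurableSet K := isClosed_closedBall.measurableSet
  have hKfin : volume K < ⊤ := measure_closedBall_lt_top
  have hKc : IsCompact K := isCompact_closedBall _ _
  have hV0 : 0 ≤ V := measureReal_nonneg
  haveI : IsFiniteMeasure (volume.restrict K) := isFiniteMeasure_restrict.2 hKfin.ne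
  -- regularity of the slices
  have hφs : ContDiff ℝ ∞ φ := contDiff_cutoff (n := ⊤) R
  have hφ2 : ContDiff ℝ 2 φ := hφs.of_le (by norm_cast)
  have hφ1 : ContDiff ℝ 1 φ := hφs.of_le (by norm_cast)
  have hΔφc : Continuous (Δ φ) := FluidPDE.continuous_laplacian hφ2
  have hDφc : Continuous (fderiv ℝ φ) := hφ1.continuous_fderiv one_ne_zero
  have huc : Continuous (u s) := (h.contDiff_velocity hs).continuous
  have hu1 : ContDiff ℝ 1 (u s) := (h.contDiff_velocity hs).of_le (by norm_cast)
  have hpc : Continuous (p s) := (h.contDiff_pressure hs).continuous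
  have hsupp : tsupport φ ⊆ K := FluidPDE.tsupport_cutoff_subset hR
  have hΔ0 : ∀ x ∉ K, (Δ φ) x = 0 := fun x hx =>
    FluidPDE.laplacian_eq_zero_of_notMem_tsupport fun h' => hx (hsupp h')
  have hD0 : ∀ x ∉ K, fderiv ℝ φ x = 0 := fun x hx => fderiv_of_notMem_tsupport ℝ fun h' => hx (hsupp h')
  -- the three integrands
  set f₁ : EuclideanSpace ℝ (Fin 3) → ℝ := fun x =>
    1 * ((Δ φ) x * ‖u s x‖ ^ 2) + fderiv ℝ φ x (u s x) * ‖u s x‖ ^ 2 with hf₁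
  set f₂ : EuclideanSpace ℝ (Fin 3) → ℝ := fun x => 2 * ((p s x - c) * fderiv ℝ φ x (u s x)) with hf₂
  set f₃ : EuclideanSpace ℝ (Fin 3) → ℝ := fun x => fderiv ℝ φ x (u s x) with hf₃
  have hDφu : Continuous fun x => fderiv ℝ φ x (u s x) := hDφc.clm_apply huc
  have hf₁c : Continuous f₁ :=
    (continuous_const.mul (hΔφc.mul (huc.norm.pow 2))).add (hDφu.mul (huc.norm.pow 2))
  have hf₂c : Continuous f₂ := continuous_const.mul ((hpc.sub continuous_const).mul hDφu)
  have hsupp₁ : ∀ x ∉ K, f₁ x = 0 := fun x hx => by simp only [hf₁, hΔ0 x hx, hD0 x hx]; simp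
  have hsupp₂ : ∀ x ∉ K, f₂ x = 0 := fun x hx => by simp only [hf₂, hD0 x hx]; simp
  have hsupp₃ : ∀ x ∉ K, f₃ x = 0 := fun x hx => by simp only [hf₃, hD0 x hx]; simp
  have hcs_of : ∀ {g : EuclideanSpace ℝ (Fin 3) → ℝ}, (∀ x ∉ K, g x = 0) → HasCompactSupport g := fun hg =>
    HasCompactSupport.of_support_subset_isCompact hKc fun x hx => by
      by_contra hxK; exact hx (hg x hxK)
  have hf₁i : Integrable f₁ := hf₁c.integrable_of_hasCompactSupport (hcs_of hsupp₁)
  have hf₂i : Integrable f₂ := hf₂c.integrable_of_hasCompactSupport (hcs_of hsupp₂)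
  have hf₃i : Integrable f₃ := hDφu.integrable_of_hasCompactSupport (hcs_of hsupp₃)
  -- the pressure constant drops out
  have hdiv0 : ∫ x, f₃ x = 0 := integral_fderiv_cutoff_apply_eq_zero (h.divFree s hs) hu1 hR
  have hsplit : ∫ x, (1 * ((Δ φ) x * ‖u s x‖ ^ 2) + fderiv ℝ φ x (u s x) * ‖u s x‖ ^ 2 +
      2 * (p s x * fderiv ℝ φ x (u s x))) = (∫ x, f₁ x) + ∫ x, f₂ x := by
    have e3 : ∀ x, 1 * ((Δ φ) x * ‖u s x‖ ^ 2) + fderiv ℝ φ x (u s x) * ‖u s x‖ ^ 2 +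
        2 * (p s x * fderiv ℝ φ x (u s x)) = f₁ x + f₂ x + (2 * c) * f₃ x := fun x => by
      simp only [hf₁, hf₂, hf₃]; ring
    have hi12 : Integrable (fun a => f₁ a + f₂ a) := hf₁i.add hf₂i
    have hi3 : Integrable (fun a => 2 * c * f₃ a) := hf₃i.const_mul (2 * c)
    have h3 : ∫ a, 2 * c * f₃ a = 0 := by rw [integral_const_mul, hdiv0, mul_zero]
    rw [integral_congr_ae (Eventually.of_forall e3), integral_add hi12 hi3,
      integral_add hf₁i hf₂i, h3, add_zero]
  rw [hsplit]
  -- pointwise bounds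
  have hDu : ∀ x, |fderiv ℝ φ x (u s x)| ≤ C₁ / R * ‖u s x‖ := fun x => by
    rw [← Real.norm_eq_abs]
    exact (ContinuousLinearMap.le_opNorm _ _).trans (mul_le_mul_of_nonneg_right (hC₁ x) (norm_nonneg _))
  have hcube : ∀ x, ‖u s x‖ ^ (3 : ℝ) = ‖u s x‖ ^ 2 * ‖u s x‖ := fun x => by
    rw [show (3 : ℝ) = ((3 : ℕ) : ℝ) by norm_num, Real.rpow_natCast]; ring
  have hb₁ : ∀ x, f₁ x ≤ C₂ / R ^ 2 * ‖u s x‖ ^ 2 + C₁ / R * ‖u s x‖ ^ (3 : ℝ) := by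
    intro x
    have h1 : 1 * ((Δ φ) x * ‖u s x‖ ^ 2) ≤ C₂ / R ^ 2 * ‖u s x‖ ^ 2 := by
      rw [one_mul]
      calc (Δ φ) x * ‖u s x‖ ^ 2 ≤ |(Δ φ) x| * ‖u s x‖ ^ 2 :=
            mul_le_mul_of_nonneg_right (le_abs_self _) (sq_nonneg _)
        _ ≤ C₂ / R ^ 2 * ‖u s x‖ ^ 2 := mul_le_mul_of_nonneg_right (hC₂ x) (sq_nonneg _)
    have h2 : fderiv ℝ φ x (u s x) * ‖u s x‖ ^ 2 ≤ C₁ / R * ‖u s x‖ ^ (3 : ℝ) := by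
      calc fderiv ℝ φ x (u s x) * ‖u s x‖ ^ 2 ≤ |fderiv ℝ φ x (u s x)| * ‖u s x‖ ^ 2 :=
            mul_le_mul_of_nonneg_right (le_abs_self _) (sq_nonneg _)
        _ ≤ (C₁ / R * ‖u s x‖) * ‖u s x‖ ^ 2 := mul_le_mul_of_nonneg_right (hDu x) (sq_nonneg _)
        _ = C₁ / R * ‖u s x‖ ^ (3 : ℝ) := by rw [hcube]; ring
    simp only [hf₁]
    linarith
  have hb₂ : ∀ x, f₂ x ≤ 2 * (C₁ / R) * (‖p s x - c‖ * ‖u s x‖) := by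
    intro x
    have h1 : (p s x - c) * fderiv ℝ φ x (u s x) ≤ ‖p s x - c‖ * (C₁ / R * ‖u s x‖) := by
      calc (p s x - c) * fderiv ℝ φ x (u s x) ≤ |(p s x - c) * fderiv ℝ φ x (u s x)| := le_abs_self _
        _ = |p s x - c| * |fderiv ℝ φ x (u s x)| := abs_mul _ _
        _ ≤ |p s x - c| * (C₁ / R * ‖u s x‖) := mul_le_mul_of_nonneg_left (hDu x) (abs_nonneg _)
        _ = ‖p s x - c‖ * (C₁ / R * ‖u s x‖) := by rw [Real.norm_eq_abs]
    simp only [hf₂]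
    nlinarith [h1]
  -- integrate `f₁` over `K`
  have h2i : IntegrableOn (fun x => ‖u s x‖ ^ 2) K volume :=
    (huc.norm.pow 2).continuousOn.integrableOn_compact hKc
  have h3c : Continuous fun x => ‖u s x‖ ^ (3 : ℝ) := (huc.norm).rpow_const fun _ => Or.inr (by norm_num)
  have h3i : IntegrableOn (fun x => ‖u s x‖ ^ (3 : ℝ)) K volume := h3c.continuousOn.integrableOn_compact hKc
  have hcub := setIntegral_norm_rpow_three_le_two huc hM he
  have hI₁ : ∫ x, f₁ x ≤ C₂ / R ^ 2 * e + C₁ / R * (M ^ 2 * V ^ (1 / 2 : ℝ) * e ^ (1 / 2 : ℝ)) := by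
    rw [← setIntegral_eq_integral_of_forall_compl_eq_zero (s := K) (fun x hx => hsupp₁ x hx)]
    have h23i : IntegrableOn (fun x => C₂ / R ^ 2 * ‖u s x‖ ^ 2 + C₁ / R * ‖u s x‖ ^ (3 : ℝ)) K volume :=
      (h2i.const_mul (C₂ / R ^ 2)).add (h3i.const_mul (C₁ / R))
    calc ∫ x in K, f₁ x ≤ ∫ x in K, (C₂ / R ^ 2 * ‖u s x‖ ^ 2 + C₁ / R * ‖u s x‖ ^ (3 : ℝ)) :=
          setIntegral_mono_on hf₁i.integrableOn h23i hKm fun x _ => hb₁ x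
      _ = C₂ / R ^ 2 * (∫ x in K, ‖u s x‖ ^ 2) + C₁ / R * ∫ x in K, ‖u s x‖ ^ (3 : ℝ) := by
          rw [integral_add (h2i.const_mul _) (h3i.const_mul _), integral_const_mul, integral_const_mul]
      _ ≤ C₂ / R ^ 2 * e + C₁ / R * (M ^ 2 * V ^ (1 / 2 : ℝ) * e ^ (1 / 2 : ℝ)) :=
          add_le_add (mul_le_mul_of_nonneg_left he hC₂0) (mul_le_mul_of_nonneg_left hcub hC₁0)
  -- integrate `f₂` over `K`: Hölder `L^{3/2} × L³`
  have hpq : (2 : ℝ).HolderConjugate 2 := Real.holderConjugate_iff.2 ⟨by norm_num, by norm_num⟩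
  have hpmc : Continuous fun x => p s x - c := hpc.sub continuous_const
  obtain ⟨Bp, hBp⟩ := hKc.exists_bound_of_continuousOn hpmc.continuousOn
  have hmem_p : MemLp (fun x => p s x - c) (ENNReal.ofReal (2 : ℝ)) (volume.restrict K) :=
    MemLp.of_bound hpmc.aestronglyMeasurable Bp
      ((ae_restrict_iff' hKm).2 (Eventually.of_forall fun x hx => hBp x hx))
  have hmem_u : MemLp (fun x => ‖u s x‖) (ENNReal.ofReal (2 : ℝ)) (volume.restrict K) :=
    MemLp.of_bound huc.norm.aestronglyMeasurable M
      (Eventually.of_forall fun x => by rw [Real.norm_eq_abs, abs_norm]; exact hM x)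
  have hHolder := integral_mul_norm_le_Lp_mul_Lq (μ := volume.restrict K) hpq hmem_p hmem_u
  simp only [norm_norm] at hHolder
  have hP32 : (∫ x in K, ‖p s x - c‖ ^ (2 : ℝ)) ^ (1 / (2 : ℝ)) ≤ P * V ^ (1 / 2 : ℝ) := by
    have e1 : (∫ x in K, ‖p s x - c‖ ^ (2 : ℝ)) = ∫ x in K, |p s x - c| ^ (2 : ℝ) := by
      simp only [Real.norm_eq_abs]
    rw [e1]
    have hI0 : 0 ≤ ∫ x in K, |p s x - c| ^ (2 : ℝ) :=
      setIntegral_nonneg hKm fun x _ => Real.rpow_nonneg (abs_nonneg _) _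
    calc (∫ x in K, |p s x - c| ^ (2 : ℝ)) ^ (1 / (2 : ℝ))
        ≤ (P ^ (2 : ℝ) * V) ^ (1 / (2 : ℝ)) := Real.rpow_le_rpow hI0 hc (by norm_num)
      _ = P * V ^ (1 / 2 : ℝ) := by
          rw [Real.mul_rpow (Real.rpow_nonneg hP _) hV0, ← Real.rpow_mul hP]; norm_num
  have hU3' : (∫ x in K, ‖u s x‖ ^ (2 : ℝ)) ^ (1 / (2 : ℝ)) ≤ e ^ (1 / 2 : ℝ) := by
    have hA : ∫ x in K, ‖u s x‖ ^ (2 : ℝ) ≤ e := by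
      have : (∫ x in K, ‖u s x‖ ^ (2 : ℝ)) = ∫ x in K, ‖u s x‖ ^ 2 := by
        refine integral_congr_ae (Eventually.of_forall fun x => ?_); exact Real.rpow_two _
      rw [this]; exact he
    rw [show (1 / (2 : ℝ)) = (1 / 2 : ℝ) by norm_num]
    exact Real.rpow_le_rpow (setIntegral_nonneg hKm fun x _ => Real.rpow_nonneg (norm_nonneg _) _) hA
      (by norm_num)
  have hpu_i : IntegrableOn (fun x => ‖p s x - c‖ * ‖u s x‖) K volume :=
    (hpmc.norm.mul huc.norm).continuousOn.integrableOn_compact hKc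
  have hI₂ : ∫ x, f₂ x ≤ 2 * (C₁ / R) * (P * V ^ (1 / 2 : ℝ) * e ^ (1 / 2 : ℝ)) := by
    rw [← setIntegral_eq_integral_of_forall_compl_eq_zero (s := K) (fun x hx => hsupp₂ x hx)]
    calc ∫ x in K, f₂ x ≤ ∫ x in K, 2 * (C₁ / R) * (‖p s x - c‖ * ‖u s x‖) :=
          setIntegral_mono_on hf₂i.integrableOn (hpu_i.const_mul _) hKm fun x _ => hb₂ x
      _ = 2 * (C₁ / R) * ∫ x in K, ‖p s x - c‖ * ‖u s x‖ := integral_const_mul _ _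
      _ ≤ 2 * (C₁ / R) * ((∫ x in K, ‖p s x - c‖ ^ (2 : ℝ)) ^ (1 / (2 : ℝ)) *
            (∫ x in K, ‖u s x‖ ^ (2 : ℝ)) ^ (1 / (2 : ℝ))) :=
          mul_le_mul_of_nonneg_left hHolder (by positivity)
      _ ≤ 2 * (C₁ / R) * (P * V ^ (1 / 2 : ℝ) * e ^ (1 / 2 : ℝ)) := by
          refine mul_le_mul_of_nonneg_left ?_ (by positivity)
          exact mul_le_mul hP32 hU3' (Real.rpow_nonneg (setIntegral_nonneg hKm fun x _ =>
            Real.rpow_nonneg (norm_nonneg _) _) _) (by positivity)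
  calc (∫ x, f₁ x) + ∫ x, f₂ x
      ≤ (C₂ / R ^ 2 * e + C₁ / R * (M ^ 2 * V ^ (1 / 2 : ℝ) * e ^ (1 / 2 : ℝ))) +
          2 * (C₁ / R) * (P * V ^ (1 / 2 : ℝ) * e ^ (1 / 2 : ℝ)) := add_le_add hI₁ hI₂
    _ = C₂ / R ^ 2 * e + C₁ / R * V ^ (1 / 2 : ℝ) * e ^ (1 / 2 : ℝ) * (M ^ 2 + 2 * P) := by ring

end Summit.NavierStokesRegularity.NavierStokesRegularity.Theorems.PoloidalWindowDoorPoloidalWindowRigidityLargeScaleEnergyBootstrapFloorTools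

end
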